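import Mathlib
import Literature.Combinatorics.Optimization.LPRelaxationsMaxCSP
import HarnessLib

/-!
# Sparse approximation by mirror descent and junta approximation (Lee–Raghavendra–Steurer 2015, §4.2.1) — PROVED

Part of the tree's Lee–Raghavendra–Steurer story (`PatternMatrixPsdRank`, `SeparatingFunctionalPsdRank`,
`DensityMatrixApproximation(Proof)`, `SosDegreeVersusPsdRank`, …).  LRS §4 ("Approximations for density
operators") is built on one principle: *high-entropy states can be approximated by simple states if
the approximation is only with respect to simple tests*.  The tree held the single-test, density-matrix
form (Thm 3.4 = Thm 4.1, `LeeRaghavendraSteurer2015_thm34_holds`).  This file PROVES the "classical"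
(diagonal) many-tests form recorded in §4.2.1, which is the junta-approximation tool of the paper's
nonnegative-rank section §7 (and, in Boolean form, of [ChanEtAl2016]):

* **Corollary 4.7** (sparse approximation of functions by mirror descent, p. 20): "For every `ε > 0`,
  the following holds. Let `X` be a finite set equipped with a probability measure `μ`. Let
  `𝒯 ⊆ L²(X, μ)` be a compact set of functions, and let `f : X → ℝ₊` be such that `E_μ f = 1`. If one
  defines `h = ⌈(8/ε²)·Ent_μ(f)·Δ(𝒯)²⌉` then there exist functions `g_1, g_2, …, g_h ∈ 𝒯` such that
  `f̃ ≝ exp((ε/(4Δ(𝒯)²)) Σ_{i=1}^h g_i) / Σ_{x ∈ X} exp((ε/(4Δ(𝒯)²)) Σ_{i=1}^h g_i(x)) μ(x)` so that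
  `E_μ f̃ = 1`, and for every `g ∈ 𝒯`, `E_{x∼μ} g(x)(f(x) − f̃(x)) ≤ ε`."  Here
  `Δ(𝒯) = sup_{g ∈ 𝒯} ‖g‖_∞` and `Ent_μ(f) = E_μ[f log f]` ("the relative entropy between `fμ` and
  `μ`", p. 20) — `LeeRaghavendraSteurer2015_cor47`.
* **Theorem 4.8** (junta approximation, p. 21): "Let `X` be an arbitrary finite set, and let `μ` denote
  a probability measure on `Xⁿ`. Consider a non-negative function `f : Xⁿ → ℝ₊` with `E_μ f = 1`, and
  let `𝒯` be a collection of `k`-juntas. Then for every `ε > 0`, there exists a non-negative `k'`-junta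
  `f̃ : Xⁿ → ℝ₊` with `E_μ f̃ = 1`, where `k' ≲ (k/ε²)·D(f ‖ μ)·Δ(𝒯)²`, and such that for every `g ∈ 𝒯`,
  `E_{x∼μ} g(x)(f(x) − f̃(x)) ≤ ε`."  (p. 21: "`f` is called an `S`-junta if `f` only depends (at most)
  on the coordinates in `S` … `f` is a `k`-junta if it is an `S`-junta for a set with `|S| = k`";
  p. 10: "`A ≲ B`" means `A ≤ C·B` for a universal constant `C`) — `LeeRaghavendraSteurer2015_thm48`,
  with the explicit universal constant `C = 16/3`.

## Rendering decisions (recorded, none changes the content)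

* A probability measure on a finite set is a weight `μ : X → ℝ`, `μ ≥ 0`, `Σ μ = 1` (`IsProbWeight`);
  `E_μ g = Σ_x μ(x) g(x)` (`muExpect`); `Ent_μ(f) = D(f‖μ) = Σ_x μ(x) f(x) log f(x)` (`densityEntropy`,
  Mathlib's `Real.log` with `0 log 0 = 0`); the prescribed approximator of eq. (4.7)/(prescribed-cor) is
  `gibbsDensity μ η G = exp(η G)/E_μ exp(η G)` with `G = Σ_i g_i`, `η = ε/(4Δ²)`.
* "`𝒯` compact, `Δ(𝒯) = sup ‖g‖_∞`": for a finite `X` compactness only serves to make the supremum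
  finite; the theorems are stated for an arbitrary set `𝒯` of functions with any bound `Δ > 0` on their
  sup-norms (a larger `Δ` weakens both conclusions, as in the tree's rendering of Thm 3.4).
* "there exist `g_1, …, g_h` with `h = ⌈8 Ent Δ²/ε²⌉`": the printed proof (of Lemma 4.6, p. 20: "Thus
  we either find an approximator `Q̃_i` for some `i = 0, 1, …, h` … or …") stops at the FIRST good
  iterate, i.e. it delivers `g_1, …, g_{h'}` for some `h' ≤ h` (padding to exactly `h` functions is not
  possible unless `0 ∈ 𝒯`); the theorem is typed with `h' ≤ ⌈8 Ent Δ²/ε²⌉`.  The potential argument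
  in fact gives `h' ≤ (16/3)·Ent·Δ²/ε²` (`LeeRaghavendraSteurer2015_cor47`, last conjunct), which is
  what makes the "`≲`" of Theorem 4.8 literally true (no additive `+k` for the ceiling).
* Theorem 4.8: `Xⁿ` is `ι → X` for an arbitrary finite index type `ι` (the paper's `n = |ι|`);
  `k`-juntas on `ι → X` are `IsKJunta k` (`IsSJunta S` = "`S`-junta"); for `X = {0,1}`, `ι = Fin n` this
  is the tree's `IsJunta` of `LPRelaxationsMaxCSP.lean` (`isKJunta_iff_isJunta`), and the uniform cube
  measure gives the tree's `cubeExpect` (`muExpect_uniformCube`).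

## Proof (as printed, discretised)

LRS prove Lemma 4.6 by a continuous-time mirror-descent / matrix-multiplicative-weights argument and
note (p. 20) that the classical case "can be proved exactly along the same lines, but without the use of
matrix inequalities".  We run the discrete version of that argument: with `G_i = g_1 + ⋯ + g_i`,
`f̃_i = gibbsDensity μ η G_i` and the potential `Φ_i = D(fμ ‖ f̃_i μ) = Ent_μ(f) − η E_μ[f G_i] +
log E_μ e^{η G_i}` (`mdPotential`) one has `Φ_0 = Ent_μ(f)`, `Φ_i ≥ 0` (Gibbs' inequality,
`densityEntropy_sub_muExpect_log_nonneg`), and — the one inequality — if a test `g ∈ 𝒯` still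
distinguishes, `E_μ g (f − f̃_i) > ε`, then `Φ_{i+1} < Φ_i − (ηε − η²Δ²) = Φ_i − 3ε²/(16Δ²)`
(`mdPotential_add_lt`, from `log E_{f̃_i μ} e^{ηg} ≤ η E_{f̃_i μ} g + η²Δ²` via `e^u ≤ 1 + u + u²` for
`|u| ≤ 1` and `Var ≤ Δ²`; the side condition `2ηΔ ≤ 1`, i.e. `ε ≤ 2Δ`, is automatic because a
distinguishing test forces `ε < 2Δ`).  Hence the descent stops after at most `Ent/(3ε²/16Δ²) ≤
8 Ent Δ²/ε²` steps at a good iterate (`LeeRaghavendraSteurer2015_cor47`); the iterate is a function of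
`G`, which depends on the union of the `≤ h'` junta sets of the chosen tests (`LeeRaghavendraSteurer2015_thm48`).

0 named facts; no `sorry`.  Source: J. R. Lee, P. Raghavendra, D. Steurer, *Lower bounds on the size of
semidefinite programming relaxations*, STOC 2015 [LeeRaghavendraSteurer2015]; held text
`paper:arxiv-1411.6317` (arXiv rendering; locators "p. N" = its pages): §4.2 Lemma 4.6 (p. 19–20),
§4.2.1 Cor. 4.7 (p. 20), Thm 4.8 (p. 21).
-/

noncomputable section

open Finset Real

namespace Literature.Combinatorics.Optimization

/-! ### Finite probability spaces: weights, expectation, densities, relative entropy -/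

section FiniteProbability

variable {α : Type*} [Fintype α]

/-- `μ : X → ℝ` is a **probability measure on the finite set `X`**: nonnegative weights summing to `1`.
[cite: LeeRaghavendraSteurer2015, §4.2.1 (p. 20: "a finite set equipped with a probability measure μ … writing μ(x) for μ({x})")] -/
structure IsProbWeight (μ : α → ℝ) : Prop where
  nonneg : ∀ x, 0 ≤ μ x
  sum_eq_one : ∑ x, μ x = 1

/-- **Expectation** `E_μ g = Σ_x μ(x) g(x)`. [cite: LeeRaghavendraSteurer2015, §4.2.1 (p. 20: "E_μ")] -/
def muExpect (μ : α → ℝ) (g : α → ℝ) : ℝ := ∑ x, μ x * g x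

/-- **Relative entropy of a density**: for `f ≥ 0` with `E_μ f = 1`,
`Ent_μ(f) = D(f ‖ μ) = E_μ[f log f]`, "the relative entropy between `fμ` and `μ`" (`0 log 0 = 0`).
[cite: LeeRaghavendraSteurer2015, §4.2.1 (p. 20)] -/
def densityEntropy (μ : α → ℝ) (f : α → ℝ) : ℝ := ∑ x, μ x * (f x * Real.log (f x))

/-- The normalising constant `E_μ e^{η G} = Σ_x e^{η G(x)} μ(x)` of the prescribed approximator.
[cite: LeeRaghavendraSteurer2015, Cor. 4.7 (p. 20, eq. for f̃)] -/
def partitionFn (μ : α → ℝ) (η : ℝ) (G : α → ℝ) : ℝ := ∑ y, μ y * Real.exp (η * G y)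

/-- **The prescribed approximator** `f̃ = e^{η G} / Σ_x e^{η G(x)} μ(x)` (a density with respect to `μ`;
in Cor. 4.7, `G = Σ_i g_i` and `η = ε/(4Δ(𝒯)²)`). [cite: LeeRaghavendraSteurer2015, Cor. 4.7 (p. 20)] -/
def gibbsDensity (μ : α → ℝ) (η : ℝ) (G : α → ℝ) : α → ℝ :=
  fun x => Real.exp (η * G x) / partitionFn μ η G

/-! #### Elementary API -/

/-- Linearity of `E_μ`. [cite: LeeRaghavendraSteurer2015, §4.2.1 (p. 20)] -/
theorem muExpect_add (μ g h : α → ℝ) :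
    muExpect μ (fun x => g x + h x) = muExpect μ g + muExpect μ h := by
  simp only [muExpect, mul_add, sum_add_distrib]

/-- Linearity of `E_μ`. [cite: LeeRaghavendraSteurer2015, §4.2.1 (p. 20)] -/
theorem muExpect_sub (μ g h : α → ℝ) :
    muExpect μ (fun x => g x - h x) = muExpect μ g - muExpect μ h := by
  simp only [muExpect, mul_sub, sum_sub_distrib]

/-- Linearity of `E_μ`. [cite: LeeRaghavendraSteurer2015, §4.2.1 (p. 20)] -/
theorem muExpect_const_mul (μ g : α → ℝ) (c : ℝ) :
    muExpect μ (fun x => c * g x) = c * muExpect μ g := by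
  simp only [muExpect, mul_sum]
  exact sum_congr rfl fun x _ => by ring

/-- Linearity of `E_μ`. [cite: LeeRaghavendraSteurer2015, §4.2.1 (p. 20)] -/
theorem muExpect_neg (μ g : α → ℝ) : muExpect μ (fun x => -g x) = -muExpect μ g := by
  simp only [muExpect, mul_neg, sum_neg_distrib]

/-- `E_μ 0 = 0`. [cite: LeeRaghavendraSteurer2015, §4.2.1 (p. 20)] -/
theorem muExpect_zero (μ : α → ℝ) : muExpect μ (fun _ => 0) = 0 := by simp [muExpect]

/-- `E_μ` respects pointwise equality. [cite: LeeRaghavendraSteurer2015, §4.2.1 (p. 20)] -/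
theorem muExpect_congr {μ g h : α → ℝ} (hgh : ∀ x, g x = h x) : muExpect μ g = muExpect μ h := by
  simp only [muExpect, hgh]

/-- `E_μ c = c` for a probability measure. [cite: LeeRaghavendraSteurer2015, §4.2.1 (p. 20)] -/
theorem IsProbWeight.muExpect_const {μ : α → ℝ} (hμ : IsProbWeight μ) (c : ℝ) :
    muExpect μ (fun _ => c) = c := by
  simp only [muExpect, ← sum_mul, hμ.sum_eq_one, one_mul]

/-- Positivity of `E_μ`. [cite: LeeRaghavendraSteurer2015, §4.2.1 (p. 20)] -/
theorem IsProbWeight.muExpect_nonneg {μ : α → ℝ} (hμ : IsProbWeight μ) {g : α → ℝ}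
    (hg : ∀ x, 0 ≤ g x) : 0 ≤ muExpect μ g :=
  sum_nonneg fun x _ => mul_nonneg (hμ.nonneg x) (hg x)

/-- Monotonicity of `E_μ`. [cite: LeeRaghavendraSteurer2015, §4.2.1 (p. 20)] -/
theorem IsProbWeight.muExpect_mono {μ : α → ℝ} (hμ : IsProbWeight μ) {g h : α → ℝ}
    (hgh : ∀ x, g x ≤ h x) : muExpect μ g ≤ muExpect μ h :=
  sum_le_sum fun x _ => mul_le_mul_of_nonneg_left (hgh x) (hμ.nonneg x)

/-- `|E_μ[g·p]| ≤ Δ · E_μ p` for `|g| ≤ Δ` and `p ≥ 0`. [cite: LeeRaghavendraSteurer2015, §4.2.1 (p. 20)] -/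
theorem IsProbWeight.abs_muExpect_mul_le {μ : α → ℝ} (hμ : IsProbWeight μ) {g p : α → ℝ} {Δ : ℝ}
    (hg : ∀ x, |g x| ≤ Δ) (hp : ∀ x, 0 ≤ p x) :
    |muExpect μ (fun x => g x * p x)| ≤ Δ * muExpect μ p := by
  unfold muExpect
  rw [mul_sum]
  refine (abs_sum_le_sum_abs _ _).trans (sum_le_sum fun x _ => ?_)
  rw [abs_mul, abs_of_nonneg (hμ.nonneg x), abs_mul, abs_of_nonneg (hp x)]
  calc μ x * (|g x| * p x) ≤ μ x * (Δ * p x) :=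
        mul_le_mul_of_nonneg_left (mul_le_mul_of_nonneg_right (hg x) (hp x)) (hμ.nonneg x)
    _ = Δ * (μ x * p x) := by ring

/-- A probability weight has a point of positive mass. [cite: LeeRaghavendraSteurer2015, §4.2.1 (p. 20)] -/
theorem IsProbWeight.exists_pos {μ : α → ℝ} (hμ : IsProbWeight μ) : ∃ x, 0 < μ x := by
  by_contra h
  push Not at h
  have : ∑ x, μ x ≤ 0 := sum_nonpos fun x _ => h x
  linarith [hμ.sum_eq_one]

/-- The normalising constant `Σ_x e^{ηG(x)} μ(x)` is positive. [cite: LeeRaghavendraSteurer2015, §4.2.1 (p. 20)] -/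
theorem IsProbWeight.partitionFn_pos {μ : α → ℝ} (hμ : IsProbWeight μ) (η : ℝ) (G : α → ℝ) :
    0 < partitionFn μ η G := by
  obtain ⟨x₀, hx₀⟩ := hμ.exists_pos
  unfold partitionFn
  calc (0 : ℝ) < μ x₀ * Real.exp (η * G x₀) := mul_pos hx₀ (Real.exp_pos _)
    _ ≤ ∑ y, μ y * Real.exp (η * G y) :=
        single_le_sum (f := fun y => μ y * Real.exp (η * G y))
          (fun y _ => mul_nonneg (hμ.nonneg y) (Real.exp_pos _).le) (mem_univ x₀)

/-- The prescribed approximator is (strictly) positive. [cite: LeeRaghavendraSteurer2015, §4.2.1 (p. 20)] -/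
theorem IsProbWeight.gibbsDensity_pos {μ : α → ℝ} (hμ : IsProbWeight μ) (η : ℝ) (G : α → ℝ)
    (x : α) : 0 < gibbsDensity μ η G x :=
  div_pos (Real.exp_pos _) (hμ.partitionFn_pos η G)

/-- `E_μ f̃ = 1`: the prescribed approximator is a density. [cite: LeeRaghavendraSteurer2015, Cor. 4.7 (p. 20: "so that E_μ f̃ = 1")] -/
theorem IsProbWeight.muExpect_gibbsDensity {μ : α → ℝ} (hμ : IsProbWeight μ) (η : ℝ) (G : α → ℝ) :
    muExpect μ (gibbsDensity μ η G) = 1 := by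
  have hZ := hμ.partitionFn_pos η G
  unfold muExpect gibbsDensity
  simp_rw [mul_div_assoc', ← sum_div]
  exact div_self hZ.ne'

/-- `Σ_x e^{0} μ(x) = 1`. [cite: LeeRaghavendraSteurer2015, §4.2.1 (p. 20)] -/
theorem IsProbWeight.partitionFn_zero {μ : α → ℝ} (hμ : IsProbWeight μ) (η : ℝ) :
    partitionFn μ η (fun _ => 0) = 1 := by
  simp [partitionFn, hμ.sum_eq_one]

/-- With no test chosen the approximator is the constant density `1` ("Q̃_0 = U"). [cite: LeeRaghavendraSteurer2015, proof of Lemma 4.6 (p. 20)] -/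
theorem IsProbWeight.gibbsDensity_zero {μ : α → ℝ} (hμ : IsProbWeight μ) (η : ℝ) (x : α) :
    gibbsDensity μ η (fun _ => 0) x = 1 := by
  simp [gibbsDensity, hμ.partitionFn_zero]

/-- The partition function of `G + g` relative to that of `G` is the `f̃_G μ`-expectation of `e^{ηg}`.
[cite: LeeRaghavendraSteurer2015, proof of Lemma 4.6 (p. 20)] -/
theorem IsProbWeight.partitionFn_add {μ : α → ℝ} (hμ : IsProbWeight μ) (η : ℝ) (G g : α → ℝ) :
    partitionFn μ η (fun x => G x + g x) =
      partitionFn μ η G * muExpect μ (fun x => gibbsDensity μ η G x * Real.exp (η * g x)) := by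
  have hZ := hμ.partitionFn_pos η G
  have key : muExpect μ (fun x => gibbsDensity μ η G x * Real.exp (η * g x)) =
      partitionFn μ η (fun x => G x + g x) / partitionFn μ η G := by
    unfold muExpect gibbsDensity
    rw [show partitionFn μ η (fun x => G x + g x) =
        ∑ x, μ x * (Real.exp (η * G x) * Real.exp (η * g x)) from
      sum_congr rfl fun x _ => by rw [mul_add, Real.exp_add], sum_div]
    exact sum_congr rfl fun x _ => by ring
  rw [key, mul_div_assoc', mul_div_cancel_left₀ _ hZ.ne']

/-! #### Gibbs' inequality and the mirror-descent potential -/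

/-- Pointwise form of Gibbs' inequality: `f log f − f log p ≥ f − p` for `f ≥ 0`, `p > 0`. [cite: LeeRaghavendraSteurer2015, proof of Lemma 4.6 (p. 20)] -/
theorem mul_log_sub_mul_log_ge {a p : ℝ} (ha : 0 ≤ a) (hp : 0 < p) :
    a - p ≤ a * Real.log a - a * Real.log p := by
  rcases ha.eq_or_lt with h | h
  · rw [← h]; simp [hp.le]
  · have h1 : Real.log (p / a) ≤ p / a - 1 := Real.log_le_sub_one_of_pos (div_pos hp h)
    rw [Real.log_div hp.ne' h.ne'] at h1
    have h2 : a * (Real.log p - Real.log a) ≤ a * (p / a - 1) := mul_le_mul_of_nonneg_left h1 ha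
    have h3 : a * (p / a - 1) = p - a := by field_simp
    linarith

/-- **Gibbs' inequality** on a finite probability space: for densities `f ≥ 0` and `p > 0`
(`E_μ f = E_μ p = 1`), `E_μ[f log f] ≥ E_μ[f log p]`, i.e. `D(fμ ‖ pμ) ≥ 0`. [cite: LeeRaghavendraSteurer2015, proof of Lemma 4.6 (p. 20)] -/
theorem densityEntropy_sub_muExpect_log_nonneg {μ : α → ℝ} (hμ : IsProbWeight μ) {f p : α → ℝ}
    (hf0 : ∀ x, 0 ≤ f x) (hf1 : muExpect μ f = 1) (hp0 : ∀ x, 0 < p x) (hp1 : muExpect μ p = 1) :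
    0 ≤ densityEntropy μ f - muExpect μ (fun x => f x * Real.log (p x)) := by
  have h : muExpect μ f - muExpect μ p ≤
      densityEntropy μ f - muExpect μ (fun x => f x * Real.log (p x)) := by
    unfold muExpect densityEntropy
    rw [← sum_sub_distrib, ← sum_sub_distrib]
    refine sum_le_sum fun x _ => ?_
    rw [← mul_sub, ← mul_sub]
    exact mul_le_mul_of_nonneg_left (mul_log_sub_mul_log_ge (hf0 x) (hp0 x)) (hμ.nonneg x)
  linarith

/-- In particular `Ent_μ(f) ≥ 0` for a density `f`. [cite: LeeRaghavendraSteurer2015, proof of Lemma 4.6 (p. 20)] -/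
theorem densityEntropy_nonneg {μ : α → ℝ} (hμ : IsProbWeight μ) {f : α → ℝ}
    (hf0 : ∀ x, 0 ≤ f x) (hf1 : muExpect μ f = 1) : 0 ≤ densityEntropy μ f := by
  have h := densityEntropy_sub_muExpect_log_nonneg hμ hf0 hf1 (p := fun _ => 1)
    (fun _ => one_pos) (hμ.muExpect_const 1)
  simpa [Real.log_one, muExpect_zero] using h

/-- The mirror-descent potential `Φ(G) = Ent_μ(f) − η E_μ[f G] + log E_μ e^{ηG}` (which equals
`D(fμ ‖ f̃_G μ)` for a density `f`, `mdPotential_eq`). [cite: LeeRaghavendraSteurer2015, proof of Lemma 4.6 (p. 20: the potential S(Q‖Q_t))] -/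
def mdPotential (μ f : α → ℝ) (η : ℝ) (G : α → ℝ) : ℝ :=
  densityEntropy μ f - η * muExpect μ (fun x => f x * G x) + Real.log (partitionFn μ η G)

/-- `Φ(G) = E_μ[f log f] − E_μ[f log f̃_G] = D(fμ ‖ f̃_G μ)` for a density `f`. [cite: LeeRaghavendraSteurer2015, proof of Lemma 4.6 (p. 20)] -/
theorem mdPotential_eq {μ : α → ℝ} (hμ : IsProbWeight μ) {f : α → ℝ} (hf1 : muExpect μ f = 1)
    (η : ℝ) (G : α → ℝ) :
    mdPotential μ f η G =
      densityEntropy μ f - muExpect μ (fun x => f x * Real.log (gibbsDensity μ η G x)) := by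
  have hZ := hμ.partitionFn_pos η G
  have hlog : ∀ x, Real.log (gibbsDensity μ η G x) = η * G x - Real.log (partitionFn μ η G) := by
    intro x
    unfold gibbsDensity
    rw [Real.log_div (Real.exp_pos _).ne' hZ.ne', Real.log_exp]
  simp_rw [hlog, mul_sub, muExpect_sub]
  have h1 : muExpect μ (fun x => f x * (η * G x)) = η * muExpect μ (fun x => f x * G x) := by
    rw [← muExpect_const_mul]; exact muExpect_congr fun x => by ring
  have h2 : muExpect μ (fun x => f x * Real.log (partitionFn μ η G)) =
      Real.log (partitionFn μ η G) := by
    have : muExpect μ (fun x => f x * Real.log (partitionFn μ η G)) =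
        Real.log (partitionFn μ η G) * muExpect μ f := by
      rw [← muExpect_const_mul]; exact muExpect_congr fun x => by ring
    rw [this, hf1, mul_one]
  rw [h1, h2, mdPotential]
  ring

/-- `Φ(G) ≥ 0`. [cite: LeeRaghavendraSteurer2015, proof of Lemma 4.6 (p. 20: "contradicts the fact that S(Q‖Q_T) ≥ 0")] -/
theorem mdPotential_nonneg {μ : α → ℝ} (hμ : IsProbWeight μ) {f : α → ℝ} (hf0 : ∀ x, 0 ≤ f x)
    (hf1 : muExpect μ f = 1) (η : ℝ) (G : α → ℝ) : 0 ≤ mdPotential μ f η G := by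
  rw [mdPotential_eq hμ hf1]
  exact densityEntropy_sub_muExpect_log_nonneg hμ hf0 hf1 (hμ.gibbsDensity_pos η G)
    (hμ.muExpect_gibbsDensity η G)

/-- `Φ(0) = Ent_μ(f)` (the descent starts at the uniform density `f̃_0 = 1`). [cite: LeeRaghavendraSteurer2015, proof of Lemma 4.6 (p. 20: "Q̃_0 = U")] -/
theorem mdPotential_zero {μ : α → ℝ} (hμ : IsProbWeight μ) (f : α → ℝ) (η : ℝ) :
    mdPotential μ f η (fun _ => 0) = densityEntropy μ f := by
  simp [mdPotential, hμ.partitionFn_zero, muExpect]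

/-- **The one inequality of the descent** (discrete replacement of eq. (4.6)/(magic)): for a test with
`|g| ≤ Δ` and a step size with `2ηΔ ≤ 1`,
`log E_μ e^{η(G+g)} ≤ log E_μ e^{ηG} + η E_{f̃_G μ}[g] + η²Δ²`.
[cite: LeeRaghavendraSteurer2015, proof of Lemma 4.6 (p. 19–20, eq. (magic))] -/
theorem log_partitionFn_add_le {μ : α → ℝ} (hμ : IsProbWeight μ) {η Δ : ℝ} (hη : 0 ≤ η)
    {g : α → ℝ} (hg : ∀ x, |g x| ≤ Δ) (hηΔ : 2 * η * Δ ≤ 1) (G : α → ℝ) :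
    Real.log (partitionFn μ η (fun x => G x + g x)) ≤
      Real.log (partitionFn μ η G) + η * muExpect μ (fun x => gibbsDensity μ η G x * g x)
        + η ^ 2 * Δ ^ 2 := by
  set p := gibbsDensity μ η G with hp_def
  have hp0 : ∀ x, 0 < p x := hμ.gibbsDensity_pos η G
  have hp1 : muExpect μ p = 1 := hμ.muExpect_gibbsDensity η G
  have hZ := hμ.partitionFn_pos η G
  set c := muExpect μ (fun x => p x * g x) with hc_def
  have hΔ0 : 0 ≤ Δ := by
    obtain ⟨x₀, _⟩ := hμ.exists_pos
    exact (abs_nonneg _).trans (hg x₀)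
  -- |c| ≤ Δ
  have hc : |c| ≤ Δ := by
    have := hμ.abs_muExpect_mul_le hg (fun x => (hp0 x).le)
    rw [hp1, mul_one] at this
    rw [hc_def]
    calc |muExpect μ (fun x => p x * g x)| = |muExpect μ (fun x => g x * p x)| := by
          rw [muExpect_congr fun x => mul_comm (p x) (g x)]
      _ ≤ Δ := this
  -- the centred exponential moment
  have hu : ∀ x, |η * (g x - c)| ≤ 1 := by
    intro x
    rw [abs_mul, abs_of_nonneg hη]
    have : |g x - c| ≤ 2 * Δ := by
      calc |g x - c| ≤ |g x| + |c| := abs_sub _ _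
        _ ≤ Δ + Δ := add_le_add (hg x) hc
        _ = 2 * Δ := by ring
    calc η * |g x - c| ≤ η * (2 * Δ) := mul_le_mul_of_nonneg_left this hη
      _ = 2 * η * Δ := by ring
      _ ≤ 1 := hηΔ
  have hexp : ∀ x, Real.exp (η * (g x - c)) ≤ 1 + η * (g x - c) + (η * (g x - c)) ^ 2 := by
    intro x
    have := (abs_le.mp (Real.abs_exp_sub_one_sub_id_le (hu x))).2
    linarith
  -- E_{pμ}[e^{η(g-c)}] ≤ 1 + η² Δ²
  have hmom : muExpect μ (fun x => p x * Real.exp (η * (g x - c))) ≤ 1 + η ^ 2 * Δ ^ 2 := by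
    have step1 : muExpect μ (fun x => p x * Real.exp (η * (g x - c))) ≤
        muExpect μ (fun x => p x * (1 + η * (g x - c) + (η * (g x - c)) ^ 2)) :=
      hμ.muExpect_mono fun x => mul_le_mul_of_nonneg_left (hexp x) (hp0 x).le
    have hsplit : muExpect μ (fun x => p x * (1 + η * (g x - c) + (η * (g x - c)) ^ 2)) =
        muExpect μ p + η * (muExpect μ (fun x => p x * g x) - c * muExpect μ p) +
          η ^ 2 * muExpect μ (fun x => p x * (g x - c) ^ 2) := by
      simp only [muExpect, mul_sum, ← sum_add_distrib, ← sum_sub_distrib]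
      exact sum_congr rfl fun x _ => by ring
    have hvar : muExpect μ (fun x => p x * (g x - c) ^ 2) ≤ Δ ^ 2 := by
      -- E[p (g-c)²] = E[p g²] − c² ≤ Δ²
      have h1 : muExpect μ (fun x => p x * (g x - c) ^ 2) =
          muExpect μ (fun x => p x * g x ^ 2) - 2 * c * muExpect μ (fun x => p x * g x)
            + c ^ 2 * muExpect μ p := by
        simp only [muExpect, mul_sum, ← sum_add_distrib, ← sum_sub_distrib]
        exact sum_congr rfl fun x _ => by ring
      have h2 : muExpect μ (fun x => p x * g x ^ 2) ≤ Δ ^ 2 := by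
        have : muExpect μ (fun x => p x * g x ^ 2) ≤ muExpect μ (fun x => p x * Δ ^ 2) := by
          refine hμ.muExpect_mono fun x => mul_le_mul_of_nonneg_left ?_ (hp0 x).le
          have := hg x
          rw [← sq_abs]
          exact pow_le_pow_left₀ (abs_nonneg _) this 2
        have h' : muExpect μ (fun x => p x * Δ ^ 2) = Δ ^ 2 := by
          have : muExpect μ (fun x => p x * Δ ^ 2) = Δ ^ 2 * muExpect μ p := by
            rw [← muExpect_const_mul]; exact muExpect_congr fun x => by ring
          rw [this, hp1, mul_one]
        linarith
      rw [h1, ← hc_def, hp1]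
      nlinarith [sq_nonneg c]
    rw [hsplit, hp1, ← hc_def] at step1
    have : η ^ 2 * muExpect μ (fun x => p x * (g x - c) ^ 2) ≤ η ^ 2 * Δ ^ 2 :=
      mul_le_mul_of_nonneg_left hvar (sq_nonneg η)
    linarith
  -- assemble
  have hmom_pos : 0 < muExpect μ (fun x => p x * Real.exp (η * (g x - c))) := by
    obtain ⟨x₀, hx₀⟩ := hμ.exists_pos
    unfold muExpect
    calc (0 : ℝ) < μ x₀ * (p x₀ * Real.exp (η * (g x₀ - c))) :=
          mul_pos hx₀ (mul_pos (hp0 x₀) (Real.exp_pos _))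
      _ ≤ ∑ x, μ x * (p x * Real.exp (η * (g x - c))) :=
          single_le_sum (f := fun x => μ x * (p x * Real.exp (η * (g x - c))))
            (fun x _ => mul_nonneg (hμ.nonneg x) (mul_nonneg (hp0 x).le (Real.exp_pos _).le))
            (mem_univ x₀)
  have hfactor : muExpect μ (fun x => p x * Real.exp (η * g x)) =
      Real.exp (η * c) * muExpect μ (fun x => p x * Real.exp (η * (g x - c))) := by
    rw [← muExpect_const_mul]
    refine muExpect_congr fun x => ?_
    rw [show η * g x = η * c + η * (g x - c) by ring, Real.exp_add]
    ring
  rw [hμ.partitionFn_add η G g, Real.log_mul hZ.ne', hfactor, Real.log_mul (Real.exp_pos _).ne'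
    hmom_pos.ne', Real.log_exp]
  · have hlog : Real.log (muExpect μ (fun x => p x * Real.exp (η * (g x - c)))) ≤ η ^ 2 * Δ ^ 2 := by
      calc Real.log (muExpect μ (fun x => p x * Real.exp (η * (g x - c))))
          ≤ muExpect μ (fun x => p x * Real.exp (η * (g x - c))) - 1 :=
            Real.log_le_sub_one_of_pos hmom_pos
        _ ≤ η ^ 2 * Δ ^ 2 := by linarith
    linarith
  · rw [hfactor]
    exact (mul_pos (Real.exp_pos _) hmom_pos).ne'

/-- **Descent step**: if a test with `|g| ≤ Δ` distinguishes `f` from the current iterate,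
`E_μ g(f − f̃_G) > ε`, and `2ηΔ ≤ 1`, then `Φ(G + g) < Φ(G) − (ηε − η²Δ²)`.
[cite: LeeRaghavendraSteurer2015, proof of Lemma 4.6 (p. 20, eq. (deriv)/(ensure))] -/
theorem mdPotential_add_lt {μ : α → ℝ} (hμ : IsProbWeight μ) (f : α → ℝ) {η Δ ε : ℝ} (hη : 0 < η)
    {g : α → ℝ} (hg : ∀ x, |g x| ≤ Δ) (hηΔ : 2 * η * Δ ≤ 1) (G : α → ℝ)
    (hdist : ε < muExpect μ (fun x => g x * (f x - gibbsDensity μ η G x))) :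
    mdPotential μ f η (fun x => G x + g x) < mdPotential μ f η G - (η * ε - η ^ 2 * Δ ^ 2) := by
  have hstep := log_partitionFn_add_le hμ hη.le hg hηΔ G
  have hsplit : muExpect μ (fun x => f x * (G x + g x)) =
      muExpect μ (fun x => f x * G x) + muExpect μ (fun x => f x * g x) := by
    rw [← muExpect_add]; exact muExpect_congr fun x => by ring
  have hd : muExpect μ (fun x => g x * (f x - gibbsDensity μ η G x)) =
      muExpect μ (fun x => f x * g x) - muExpect μ (fun x => gibbsDensity μ η G x * g x) := by
    rw [← muExpect_sub]; exact muExpect_congr fun x => by ring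
  rw [hd] at hdist
  have h := mul_lt_mul_of_pos_left hdist hη
  unfold mdPotential
  rw [hsplit]
  nlinarith

end FiniteProbability

/-! ### Corollary 4.7: sparse approximation of a density by mirror descent -/

section MirrorDescent

variable {α : Type*} [Fintype α]

/-- One forced step of the descent with the printed step size `η = ε/(4Δ²)`: a distinguishing test
`g ∈ 𝒯` lowers the potential by more than `3ε²/(16Δ²)` (a distinguishing test forces `ε < 2Δ`, which is
the side condition `2ηΔ ≤ 1`). [cite: LeeRaghavendraSteurer2015, proof of Lemma 4.6 (p. 20)] -/
private theorem md_step {μ : α → ℝ} (hμ : IsProbWeight μ) {f : α → ℝ} (hf0 : ∀ x, 0 ≤ f x)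
    (hf1 : muExpect μ f = 1) {Δ ε : ℝ} (hΔ : 0 < Δ) (hε : 0 < ε) {g : α → ℝ}
    (hg : ∀ x, |g x| ≤ Δ) (G : α → ℝ)
    (hdist : ε < muExpect μ (fun x => g x * (f x - gibbsDensity μ (ε / (4 * Δ ^ 2)) G x))) :
    mdPotential μ f (ε / (4 * Δ ^ 2)) (fun x => G x + g x) <
      mdPotential μ f (ε / (4 * Δ ^ 2)) G - 3 * ε ^ 2 / (16 * Δ ^ 2) := by
  set η := ε / (4 * Δ ^ 2) with hη_def
  have hη : 0 < η := by positivity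
  -- a distinguishing test forces ε < 2Δ
  have hε2Δ : ε < 2 * Δ := by
    have h1 := hμ.abs_muExpect_mul_le hg hf0
    have h2 := hμ.abs_muExpect_mul_le hg (fun x => (hμ.gibbsDensity_pos η G x).le)
    rw [hf1, mul_one] at h1
    rw [hμ.muExpect_gibbsDensity, mul_one] at h2
    have hsub : muExpect μ (fun x => g x * (f x - gibbsDensity μ η G x)) =
        muExpect μ (fun x => g x * f x) - muExpect μ (fun x => g x * gibbsDensity μ η G x) := by
      rw [← muExpect_sub]; exact muExpect_congr fun x => by ring
    rw [hsub] at hdist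
    have := (abs_le.mp h1).2
    have := (abs_le.mp h2).1
    linarith
  have hηΔ : 2 * η * Δ ≤ 1 := by
    rw [hη_def, show 2 * (ε / (4 * Δ ^ 2)) * Δ = ε / (2 * Δ) by field_simp; ring,
      div_le_one (by positivity)]
    linarith
  have hlt := mdPotential_add_lt hμ f hη hg hηΔ G hdist
  have hκ : η * ε - η ^ 2 * Δ ^ 2 = 3 * ε ^ 2 / (16 * Δ ^ 2) := by
    rw [hη_def]; field_simp; ring
  linarith

/-- The descent, run for `i` rounds: either a good iterate was reached after `j ≤ i` steps, or `i`
forced steps were taken; in both cases the potential certifies `Φ ≤ Ent − j·3ε²/(16Δ²)`.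
[cite: LeeRaghavendraSteurer2015, proof of Lemma 4.6 (p. 20: "we define the elements A_1,…,A_h … inductively")] -/
private theorem md_iterate {μ : α → ℝ} (hμ : IsProbWeight μ) {f : α → ℝ} (hf0 : ∀ x, 0 ≤ f x)
    (hf1 : muExpect μ f = 1) {𝒯 : Set (α → ℝ)} {Δ ε : ℝ} (hΔ : 0 < Δ) (hε : 0 < ε)
    (h𝒯 : ∀ g ∈ 𝒯, ∀ x, |g x| ≤ Δ) (i : ℕ) :
    ∃ (j : ℕ) (gs : Fin j → α → ℝ), j ≤ i ∧ (∀ l, gs l ∈ 𝒯) ∧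
      mdPotential μ f (ε / (4 * Δ ^ 2)) (fun x => ∑ l, gs l x) ≤
        densityEntropy μ f - j * (3 * ε ^ 2 / (16 * Δ ^ 2)) ∧
      ((∀ g ∈ 𝒯, muExpect μ (fun x => g x *
          (f x - gibbsDensity μ (ε / (4 * Δ ^ 2)) (fun x => ∑ l, gs l x) x)) ≤ ε) ∨ j = i) := by
  induction i with
  | zero =>
    refine ⟨0, Fin.elim0, le_rfl, fun l => l.elim0, ?_, Or.inr rfl⟩
    simp only [univ_eq_empty, sum_empty, Nat.cast_zero, zero_mul, sub_zero]
    rw [mdPotential_zero hμ]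
  | succ i ih =>
    obtain ⟨j, gs, hji, hgs, hpot, hgood⟩ := ih
    rcases hgood with hgood | hji'
    · exact ⟨j, gs, hji.trans (Nat.le_succ i), hgs, hpot, Or.inl hgood⟩
    · by_cases hG : ∀ g ∈ 𝒯, muExpect μ (fun x => g x *
          (f x - gibbsDensity μ (ε / (4 * Δ ^ 2)) (fun x => ∑ l, gs l x) x)) ≤ ε
      · exact ⟨j, gs, hji.trans (Nat.le_succ i), hgs, hpot, Or.inl hG⟩
      · push Not at hG
        obtain ⟨g, hg𝒯, hdist⟩ := hG
        have hlt := md_step hμ hf0 hf1 hΔ hε (h𝒯 g hg𝒯) (fun x => ∑ l, gs l x) hdist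
        refine ⟨j + 1, Fin.snoc gs g, by omega, ?_, ?_, Or.inr (by omega)⟩
        · intro l
          refine Fin.lastCases ?_ (fun l => ?_) l
          · simpa using hg𝒯
          · simpa using hgs l
        · have hsum : (fun x => ∑ l : Fin (j + 1), (Fin.snoc gs g : Fin (j + 1) → α → ℝ) l x) =
              fun x => (∑ l, gs l x) + g x := by
            funext x
            rw [Fin.sum_univ_castSucc]
            simp [Fin.snoc_castSucc, Fin.snoc_last]
          rw [hsum]
          push_cast
          linarith

/-- **Lee–Raghavendra–Steurer 2015, Corollary 4.7 (sparse approximation of functions by mirror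
descent).** For every `ε > 0`: let `X` be a finite set with a probability measure `μ`, let `𝒯` be a set
of functions `X → ℝ` with `‖g‖_∞ ≤ Δ` for all `g ∈ 𝒯` (`Δ > 0`), and let `f : X → ℝ₊` with `E_μ f = 1`.
Then there are `h ≤ ⌈(8/ε²)·Ent_μ(f)·Δ²⌉` functions `g_1, …, g_h ∈ 𝒯` such that
`f̃ = exp((ε/(4Δ²)) Σ_i g_i)/Σ_x exp((ε/(4Δ²)) Σ_i g_i(x)) μ(x)` satisfies `E_μ f̃ = 1` and
`E_{x∼μ} g(x)(f(x) − f̃(x)) ≤ ε` for every `g ∈ 𝒯`.  (Last conjunct, from the same potential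
argument: `h ≤ (16/3)·Ent_μ(f)·Δ²/ε²`.)  See the module docstring for the rendering of "`h = ⌈…⌉`"
as "`h ≤ ⌈…⌉`" (the printed proof stops at the first good iterate).
[cite: LeeRaghavendraSteurer2015, Cor. 4.7 (p. 20)] -/
theorem LeeRaghavendraSteurer2015_cor47 {μ : α → ℝ} (hμ : IsProbWeight μ) (𝒯 : Set (α → ℝ))
    {Δ : ℝ} (hΔ : 0 < Δ) (h𝒯 : ∀ g ∈ 𝒯, ∀ x, |g x| ≤ Δ) {f : α → ℝ} (hf0 : ∀ x, 0 ≤ f x)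
    (hf1 : muExpect μ f = 1) {ε : ℝ} (hε : 0 < ε) :
    ∃ (h : ℕ) (g : Fin h → α → ℝ), h ≤ ⌈8 / ε ^ 2 * densityEntropy μ f * Δ ^ 2⌉₊ ∧
      (∀ i, g i ∈ 𝒯) ∧
      muExpect μ (gibbsDensity μ (ε / (4 * Δ ^ 2)) (fun x => ∑ i, g i x)) = 1 ∧
      (∀ g' ∈ 𝒯, muExpect μ (fun x => g' x *
          (f x - gibbsDensity μ (ε / (4 * Δ ^ 2)) (fun x => ∑ i, g i x) x)) ≤ ε) ∧
      (h : ℝ) ≤ 16 / 3 * densityEntropy μ f * Δ ^ 2 / ε ^ 2 := by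
  set i₀ := ⌈8 / ε ^ 2 * densityEntropy μ f * Δ ^ 2⌉₊ with hi₀_def
  obtain ⟨j, gs, hji, hgs, hpot, hgood⟩ := md_iterate hμ hf0 hf1 hΔ hε h𝒯 i₀
  have hEnt := densityEntropy_nonneg hμ hf0 hf1
  have hΦ0 := mdPotential_nonneg hμ hf0 hf1 (ε / (4 * Δ ^ 2)) (fun x => ∑ l, gs l x)
  have hκ : (0 : ℝ) < 3 * ε ^ 2 / (16 * Δ ^ 2) := by positivity
  -- the real bound on the number of steps, from `0 ≤ Φ ≤ Ent − j·κ`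
  have hjκ : (j : ℝ) * (3 * ε ^ 2 / (16 * Δ ^ 2)) ≤ densityEntropy μ f := by linarith
  have hjreal : (j : ℝ) ≤ 16 / 3 * densityEntropy μ f * Δ ^ 2 / ε ^ 2 := by
    rw [le_div_iff₀ (by positivity)]
    have h' := mul_le_mul_of_nonneg_right hjκ (show (0 : ℝ) ≤ 16 * Δ ^ 2 / 3 by positivity)
    calc (j : ℝ) * ε ^ 2 = (j : ℝ) * (3 * ε ^ 2 / (16 * Δ ^ 2)) * (16 * Δ ^ 2 / 3) := by
          field_simp
      _ ≤ densityEntropy μ f * (16 * Δ ^ 2 / 3) := h'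
      _ = 16 / 3 * densityEntropy μ f * Δ ^ 2 := by ring
  have good_case : (∀ g' ∈ 𝒯, muExpect μ (fun x => g' x *
      (f x - gibbsDensity μ (ε / (4 * Δ ^ 2)) (fun x => ∑ l, gs l x) x)) ≤ ε) →
      ∃ (h : ℕ) (g : Fin h → α → ℝ), h ≤ i₀ ∧ (∀ i, g i ∈ 𝒯) ∧
        muExpect μ (gibbsDensity μ (ε / (4 * Δ ^ 2)) (fun x => ∑ i, g i x)) = 1 ∧
        (∀ g' ∈ 𝒯, muExpect μ (fun x => g' x *
            (f x - gibbsDensity μ (ε / (4 * Δ ^ 2)) (fun x => ∑ i, g i x) x)) ≤ ε) ∧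
        (h : ℝ) ≤ 16 / 3 * densityEntropy μ f * Δ ^ 2 / ε ^ 2 :=
    fun hG => ⟨j, gs, hji, hgs, hμ.muExpect_gibbsDensity _ _, hG, hjreal⟩
  rcases hgood with hgood | hji₀
  · exact good_case hgood
  · by_cases hG : ∀ g' ∈ 𝒯, muExpect μ (fun x => g' x *
        (f x - gibbsDensity μ (ε / (4 * Δ ^ 2)) (fun x => ∑ l, gs l x) x)) ≤ ε
    · exact good_case hG
    · -- `i₀` forced steps were taken and one more is still forced: the potential would turn negative
      exfalso
      push Not at hG
      obtain ⟨g, hg𝒯, hdist⟩ := hG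
      have hlt := md_step hμ hf0 hf1 hΔ hε (h𝒯 g hg𝒯) (fun x => ∑ l, gs l x) hdist
      have hΦ1 := mdPotential_nonneg hμ hf0 hf1 (ε / (4 * Δ ^ 2)) (fun x => (∑ l, gs l x) + g x)
      have hi₀ : 8 / ε ^ 2 * densityEntropy μ f * Δ ^ 2 ≤ (i₀ : ℝ) := Nat.le_ceil _
      have hi₀κ : (3 : ℝ) / 2 * densityEntropy μ f ≤ (i₀ : ℝ) * (3 * ε ^ 2 / (16 * Δ ^ 2)) := by
        have := mul_le_mul_of_nonneg_right hi₀ hκ.le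
        calc (3 : ℝ) / 2 * densityEntropy μ f
            = 8 / ε ^ 2 * densityEntropy μ f * Δ ^ 2 * (3 * ε ^ 2 / (16 * Δ ^ 2)) := by
              field_simp; ring
          _ ≤ (i₀ : ℝ) * (3 * ε ^ 2 / (16 * Δ ^ 2)) := this
      have hj : (j : ℝ) = (i₀ : ℝ) := by exact_mod_cast hji₀
      rw [hj] at hpot
      linarith

end MirrorDescent

/-! ### Juntas on `X^ι` and Theorem 4.8 -/

section Junta

variable {ι X : Type*}

/-- `f : X^ι → ℝ` is an **`S`-junta**: it depends (at most) on the coordinates in `S`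
("for all `x, x' ∈ Xⁿ`, if `x|_S = x'|_S` then `f(x) = f(x')`").
[cite: LeeRaghavendraSteurer2015, §4.2.1 (p. 21)] -/
def IsSJunta (S : Finset ι) (f : (ι → X) → ℝ) : Prop :=
  ∀ x y : ι → X, (∀ i ∈ S, x i = y i) → f x = f y

/-- `f : X^ι → ℝ` is a **`k`-junta**: an `S`-junta for some `|S| ≤ k`.
[cite: LeeRaghavendraSteurer2015, §4.2.1 (p. 21)] -/
def IsKJunta (k : ℕ) (f : (ι → X) → ℝ) : Prop := ∃ S : Finset ι, S.card ≤ k ∧ IsSJunta S f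

/-- For the Boolean cube `{0,1}ⁿ` this is the tree's `IsJunta` (Kothari–Meka–Raghavendra Def. 1.8).
[cite: KothariMekaRaghavendra2017, Def. 1.8 (p. 4)] -/
theorem isKJunta_iff_isJunta {n d : ℕ} (h : (Fin n → Bool) → ℝ) : IsKJunta d h ↔ IsJunta d h :=
  Iff.rfl

/-- An `S`-junta is a `T`-junta for `S ⊆ T`. [cite: LeeRaghavendraSteurer2015, §4.2.1 (p. 21)] -/
theorem IsSJunta.mono {S T : Finset ι} {f : (ι → X) → ℝ} (hST : S ⊆ T) (hf : IsSJunta S f) :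
    IsSJunta T f :=
  fun x y hxy => hf x y fun i hi => hxy i (hST hi)

/-- Constants are juntas. [cite: LeeRaghavendraSteurer2015, §4.2.1 (p. 21)] -/
theorem isSJunta_const (S : Finset ι) (c : ℝ) : IsSJunta S (fun _ : ι → X => c) :=
  fun _ _ _ => rfl

/-- A function of an `S`-junta is an `S`-junta. [cite: LeeRaghavendraSteurer2015, §4.2.1 (p. 21)] -/
theorem IsSJunta.comp {S : Finset ι} {f : (ι → X) → ℝ} (hf : IsSJunta S f) (φ : ℝ → ℝ) :
    IsSJunta S (fun x => φ (f x)) :=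
  fun x y hxy => by show φ (f x) = φ (f y); rw [hf x y hxy]

/-- Sums of `S`-juntas are `S`-juntas. [cite: LeeRaghavendraSteurer2015, §4.2.1 (p. 21)] -/
theorem IsSJunta.add {S : Finset ι} {f g : (ι → X) → ℝ} (hf : IsSJunta S f) (hg : IsSJunta S g) :
    IsSJunta S (fun x => f x + g x) :=
  fun x y hxy => by show f x + g x = f y + g y; rw [hf x y hxy, hg x y hxy]

/-- Products of `S`-juntas are `S`-juntas. [cite: LeeRaghavendraSteurer2015, §4.2.1 (p. 21)] -/
theorem IsSJunta.mul {S : Finset ι} {f g : (ι → X) → ℝ} (hf : IsSJunta S f) (hg : IsSJunta S g) :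
    IsSJunta S (fun x => f x * g x) :=
  fun x y hxy => by show f x * g x = f y * g y; rw [hf x y hxy, hg x y hxy]

/-- A finite sum of juntas is a junta on the union of their coordinate sets. [cite: LeeRaghavendraSteurer2015, §4.2.1 (p. 21)] -/
theorem isSJunta_sum [DecidableEq ι] {j : ℕ} (S : Fin j → Finset ι) (gs : Fin j → (ι → X) → ℝ)
    (h : ∀ l, IsSJunta (S l) (gs l)) :
    IsSJunta (Finset.univ.biUnion S) (fun x => ∑ l, gs l x) :=
  fun x y hxy => sum_congr rfl fun l _ =>
    h l x y fun i hi => hxy i (mem_biUnion.mpr ⟨l, mem_univ l, hi⟩)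

/-- A `k`-junta is a `d`-junta for `k ≤ d`. [cite: LeeRaghavendraSteurer2015, §4.2.1 (p. 21)] -/
theorem IsKJunta.mono {k d : ℕ} {f : (ι → X) → ℝ} (hkd : k ≤ d) (hf : IsKJunta k f) :
    IsKJunta d f := by
  obtain ⟨S, hS, hf⟩ := hf
  exact ⟨S, hS.trans hkd, hf⟩

/-- A function of a `k`-junta is a `k`-junta. [cite: LeeRaghavendraSteurer2015, §4.2.1 (p. 21)] -/
theorem IsKJunta.comp {k : ℕ} {f : (ι → X) → ℝ} (hf : IsKJunta k f) (φ : ℝ → ℝ) :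
    IsKJunta k (fun x => φ (f x)) := by
  obtain ⟨S, hS, hf⟩ := hf
  exact ⟨S, hS, hf.comp φ⟩

/-- A sum of `j` functions that are `k`-juntas is a `(j·k)`-junta. [cite: LeeRaghavendraSteurer2015, §4.2.1 (p. 21)] -/
theorem isKJunta_sum [DecidableEq ι] {j k : ℕ} (gs : Fin j → (ι → X) → ℝ)
    (h : ∀ l, IsKJunta k (gs l)) : IsKJunta (j * k) (fun x => ∑ l, gs l x) := by
  choose S hS hgs using h
  refine ⟨Finset.univ.biUnion S, ?_, isSJunta_sum S gs hgs⟩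
  calc (Finset.univ.biUnion S).card ≤ ∑ l, (S l).card := card_biUnion_le
    _ ≤ ∑ _l : Fin j, k := sum_le_sum fun l _ => hS l
    _ = j * k := by simp

/-- The prescribed approximator built from `k`-junta tests `g_1, …, g_j` is a `(j·k)`-junta (it is a
function of `Σ_i g_i`). [cite: LeeRaghavendraSteurer2015, proof of Thm 4.8 (p. 21: "f̃ is an hk-junta")] -/
theorem isKJunta_gibbsDensity_sum [Fintype ι] [DecidableEq ι] [Fintype X] (μ : (ι → X) → ℝ) (η : ℝ)
    {j k : ℕ} (gs : Fin j → (ι → X) → ℝ) (h : ∀ l, IsKJunta k (gs l)) :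
    IsKJunta (j * k) (gibbsDensity μ η (fun x => ∑ l, gs l x)) :=
  (isKJunta_sum gs h).comp (fun t => Real.exp (η * t) / partitionFn μ η (fun x => ∑ l, gs l x))

/-- **Lee–Raghavendra–Steurer 2015, Theorem 4.8 (junta approximation).** Let `X` be an arbitrary finite
set, `μ` a probability measure on `X^ι` (`ι` finite), `f : X^ι → ℝ₊` with `E_μ f = 1`, and `𝒯` a
collection of `k`-juntas with `‖g‖_∞ ≤ Δ` for `g ∈ 𝒯` (`Δ > 0`).  Then for every `ε > 0` there is a
nonnegative `k'`-junta `f̃ : X^ι → ℝ₊` with `E_μ f̃ = 1`, `k' ≤ (16/3)·k·D(f‖μ)·Δ²/ε²`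
("`k' ≲ (k/ε²) D(f‖μ) Δ(𝒯)²`", universal constant made explicit), such that
`E_{x∼μ} g(x)(f(x) − f̃(x)) ≤ ε` for every `g ∈ 𝒯`.
[cite: LeeRaghavendraSteurer2015, Thm 4.8 (p. 21)] -/
theorem LeeRaghavendraSteurer2015_thm48 [Fintype ι] [DecidableEq ι] [Fintype X]
    {μ : (ι → X) → ℝ} (hμ : IsProbWeight μ) {f : (ι → X) → ℝ} (hf0 : ∀ x, 0 ≤ f x)
    (hf1 : muExpect μ f = 1) {k : ℕ} (𝒯 : Set ((ι → X) → ℝ)) (h𝒯k : ∀ g ∈ 𝒯, IsKJunta k g)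
    {Δ : ℝ} (hΔ : 0 < Δ) (h𝒯Δ : ∀ g ∈ 𝒯, ∀ x, |g x| ≤ Δ) {ε : ℝ} (hε : 0 < ε) :
    ∃ (k' : ℕ) (f' : (ι → X) → ℝ),
      (k' : ℝ) ≤ 16 / 3 * k * densityEntropy μ f * Δ ^ 2 / ε ^ 2 ∧
      IsKJunta k' f' ∧ (∀ x, 0 ≤ f' x) ∧ muExpect μ f' = 1 ∧
      ∀ g ∈ 𝒯, muExpect μ (fun x => g x * (f x - f' x)) ≤ ε := by
  obtain ⟨h, gs, -, hgs, hE, hgood, hreal⟩ := LeeRaghavendraSteurer2015_cor47 hμ 𝒯 hΔ h𝒯Δ hf0 hf1 hε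
  refine ⟨h * k, gibbsDensity μ (ε / (4 * Δ ^ 2)) (fun x => ∑ i, gs i x), ?_,
    isKJunta_gibbsDensity_sum μ _ gs fun l => h𝒯k _ (hgs l),
    fun x => (hμ.gibbsDensity_pos _ _ x).le, hE, hgood⟩
  push_cast
  have := mul_le_mul_of_nonneg_right hreal (Nat.cast_nonneg k)
  calc (h : ℝ) * k ≤ 16 / 3 * densityEntropy μ f * Δ ^ 2 / ε ^ 2 * k := this
    _ = 16 / 3 * k * densityEntropy μ f * Δ ^ 2 / ε ^ 2 := by ring

end Junta

/-! ### The uniform Boolean cube -/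

/-- The uniform measure on `{0,1}^m` is a probability weight. [cite: LeeRaghavendraSteurer2015, §7.1 (p. 27: "If a measure μ is unspecified, we always refer to the uniform measure by default")] -/
theorem isProbWeight_uniformCube (m : ℕ) : IsProbWeight (fun _ : Fin m → Bool => (1 / 2 ^ m : ℝ)) where
  nonneg _ := by positivity
  sum_eq_one := by simp

/-- Under the uniform measure, `E_μ` is the tree's `cubeExpect`. [cite: LeeRaghavendraSteurer2015, §7.1 (p. 27)] -/
theorem muExpect_uniformCube {m : ℕ} (g : (Fin m → Bool) → ℝ) :
    muExpect (fun _ : Fin m → Bool => (1 / 2 ^ m : ℝ)) g = cubeExpect g := by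
  simp only [muExpect, cubeExpect, ← mul_sum]
  ring

end Literature.Combinatorics.Optimization
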